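import Literature.AlgebraicGeometry.HodgeTheory.ComplexGysinHodgeType
import Literature.AlgebraicGeometry.HodgeTheory.ComplexConjugationHolds
import Literature.AlgebraicGeometry.HodgeTheory.HodgeFiltrationModelsReductionProofs
import Literature.AlgebraicGeometry.HodgeTheory.HodgeTypeConjugation

/-!
# Exact archimedean block data from Hodge-type stability

Crux `EndoscopicMiddleDegree.OrthogonalEnveloped` (stmt-HodgeConjecture-14300), line
`middle-involution-purity`, stub `stub_archDataOfHodgeStable` (lead reshape R1).

For `X` smooth projective of dimension `2(m+1)` and any endomorphism `z` of
`H = H^{2(m+1)}(X(ℂ); ℂ)` preserving every Hodge type `(p, q)`, the written-out "exact archimedean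
block data" conjunction of the planner's `stub_archDictionary` is satisfied by JUNK data: `r := 2(m+1)+1`
slots, the all-singleton composition `b ≡ 1` (so that the Vogan–Zuckerman bidegrees of block `i` are
the single type `(i, 2(m+1) - i)`), and `S :=` the set of slots `i` such that a non-zero class of type
`(i, 2(m+1) - i)` lies in `range z`.  Clause (3) (the image of `z` is spanned by classes of the listed
types) is the Hodge decomposition `c = z c' = Σ_{p+q=2(m+1)} z c'_{pq}` read in one Hodge model
(`HodgeModel.exists_sum_eq_of_hodgeDecomposition`, `isOfHodgeType_iff_mem_hodgePQ`); clause (4)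
(each listed type occurs) is the definition of `S`.

## References

* [VoisinHodgeI2002] C. Voisin, Hodge Theory and Complex Algebraic Geometry I, CUP 2002, §6.1.3, §7.1.1.
* [BergeronMillsonMoeglin2016Balls] N. Bergeron, J. Millson, C. Moeglin, The Hodge conjecture and arithmetic
  quotients of complex balls, Acta Math. 216 (2016) (arXiv:1306.1515), §2.2 and §5 (the block
  combinatorics `ajTypes`).
-/

noncomputable section

set_option linter.dupNamespace false

namespace Summit.HodgeConjecture.HodgeConjecture.Cruxes.OrthogonalEnveloped.MiddleInvolutionPurity

open scoped BigOperators
open CategoryTheory MonoidalCategory CartesianMonoidalCategory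
open Literature.AlgebraicGeometry.Motives (SchemeOver ComplexPoints IsSmoothProjective)
open Literature.AlgebraicGeometry.HodgeTheory
-- (the skeleton also opens `Literature.AlgebraicGeometry.ShimuraVarieties`; no name of this file's
-- signatures lives there, and the namespace is not available from the present imports)
open Literature.AlgebraicTopology.SingularHomology

/-- **Vogan–Zuckerman bidegrees of an Adams–Johnson member, as block combinatorics** (card
`middle-involution-purity`, first lemma; verbatim from `IdeatorOneSketch.lean`). [cite: BergeronMillsonMoeglin2016Balls, §2.2 and §5] -/
def ajTypes {r : ℕ} (b : Fin r → ℕ) (i : Fin r) : Finset (ℕ × ℕ) :=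
  (Finset.range (b i)).image fun j ↦
    ((∑ k ∈ Finset.univ.filter (· < i), b k) + j, (∑ k ∈ Finset.univ.filter (i < ·), b k) + j)

/-- The degree-`k` bidegrees of the members at the blocks of `S`. [cite: BergeronMillsonMoeglin2016Balls, §5] -/
def ajTypesOf {r : ℕ} (b : Fin r → ℕ) (S : Finset (Fin r)) (k : ℕ) : Finset (ℕ × ℕ) :=
  (S.biUnion fun i ↦ ajTypes b i).filter fun pq ↦ pq.1 + pq.2 = k

/-- Membership in `ajTypesOf`: a bidegree of a member at a block of `S`, of total degree `k`.
[cite: BergeronMillsonMoeglin2016Balls, §5] -/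
theorem archData_mem_ajTypesOf {r : ℕ} {b : Fin r → ℕ} {S : Finset (Fin r)} {k : ℕ} {pq : ℕ × ℕ} :
    pq ∈ ajTypesOf b S k ↔ (∃ i ∈ S, pq ∈ ajTypes b i) ∧ pq.1 + pq.2 = k := by
  simp [ajTypesOf, Finset.mem_filter, Finset.mem_biUnion]

/-- For the all-singleton composition `b ≡ 1` of `r` slots, block `i` has the single Vogan–Zuckerman
bidegree `(i, r - 1 - i)` (`i` slots above, `r - 1 - i` slots below). [cite: BergeronMillsonMoeglin2016Balls, §5] -/
theorem archData_mem_ajTypes_one_iff {r : ℕ} (i : Fin r) (pq : ℕ × ℕ) :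
    pq ∈ ajTypes (fun _ : Fin r ↦ (1 : ℕ)) i ↔ pq = (i.val, r - 1 - i.val) := by
  simp only [ajTypes, Finset.mem_image, Finset.mem_range, Nat.lt_one_iff, exists_eq_left, add_zero,
    Finset.sum_const, smul_eq_mul, mul_one]
  rw [Finset.filter_gt_eq_Iio, Finset.filter_lt_eq_Ioi, Fin.card_Iio, Fin.card_Ioi, eq_comm]

/-- **Exact archimedean data from Hodge-type stability** (lead reshape R1 of line
`middle-involution-purity`; pure Hodge-decomposition bookkeeping). For `X` smooth projective of
dimension `2(m+1)` and ANY endomorphism `z` of `H = H^{2(m+1)}(X(ℂ); ℂ)` preserving every Hodge type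
`(p, q)`, there are block data `(b, S)` satisfying the written-out ArchData conjunction: take
`r := 2(m+1)+1`, `b ≡ 1` (all blocks singletons, so `ajTypes b i = {(i, 2(m+1) - i)}`), and
`S := {i | some non-zero class of type (i, 2(m+1) - i) lies in range z}`; clause (3) holds because every
`c = z c' ∈ range z` is `Σ_{p+q=2(m+1)} z c'_{pq}` (Hodge decomposition of `c'` in one Hodge model,
`HodgeModel.exists_sum_eq_of_hodgeDecomposition` + `isOfHodgeType_iff_mem_hodgePQ`), each `z c'_{pq}`
being of type `(p,q)` and in `range z`, hence zero or witnessing `p ∈ S`; clause (4) is the definition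
of `S`. [cite: VoisinHodgeI2002, §6.1.3 and §7.1.1] -/
theorem stub_archDataOfHodgeStable :
    ∀ (m : ℕ) (X : SchemeOver ℂ), IsSmoothProjective (2 * (m + 1)) X →
      ∀ z : Module.End ℂ (complexBetti X (2 * (m + 1))),
        (∀ (p q : ℕ) (c : complexBetti X (2 * (m + 1))),
          IsOfHodgeType (2 * (m + 1)) X (2 * (m + 1)) p q c →
            IsOfHodgeType (2 * (m + 1)) X (2 * (m + 1)) p q (z c)) →
        ∃ (r : ℕ) (b : Fin r → ℕ) (S : Finset (Fin r)),
          ((∑ k, b k = 2 * (m + 1) + 1) ∧ (∀ i ∈ S, ∀ j ∈ S, b i = b j) ∧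
          LinearMap.range z ≤ Submodule.span ℂ {c : complexBetti X (2 * (m + 1)) |
            ∃ pq ∈ ajTypesOf b S (2 * (m + 1)), IsOfHodgeType (2 * (m + 1)) X (2 * (m + 1)) pq.1 pq.2 c} ∧
          ∀ pq ∈ ajTypesOf b S (2 * (m + 1)), ∃ c ∈ LinearMap.range z, c ≠ 0 ∧
            IsOfHodgeType (2 * (m + 1)) X (2 * (m + 1)) pq.1 pq.2 c) := by
  intro m X hX z hz
  classical
  obtain ⟨A⟩ := nonempty_hodgeModel_holds.nonempty hX
  refine ⟨2 * (m + 1) + 1, fun _ ↦ 1,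
    Finset.univ.filter fun i : Fin (2 * (m + 1) + 1) ↦ ∃ c ∈ LinearMap.range z, c ≠ 0 ∧
      IsOfHodgeType (2 * (m + 1)) X (2 * (m + 1)) i.val (2 * (m + 1) - i.val) c,
    by simp, fun _ _ _ _ ↦ rfl, ?_, ?_⟩
  · -- clause (3): the image of `z` is spanned by classes of the occurring types
    rintro c ⟨c', rfl⟩
    obtain ⟨w, hw, hwA⟩ := A.exists_sum_eq_of_hodgeDecomposition (2 * (m + 1)) c'
    rw [← hw, map_sum]
    refine Submodule.sum_mem _ fun pq hpq ↦ ?_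
    have hdeg : pq.1 + pq.2 = 2 * (m + 1) := Finset.HasAntidiagonal.mem_antidiagonal.1 hpq
    have htype : IsOfHodgeType (2 * (m + 1)) X (2 * (m + 1)) pq.1 pq.2 (z (w pq)) :=
      hz _ _ _ ((isOfHodgeType_iff_mem_hodgePQ hX A (w pq)).2 (hwA pq hpq))
    by_cases h0 : z (w pq) = 0
    · rw [h0]; exact Submodule.zero_mem _
    refine Submodule.subset_span ⟨pq, ?_, htype⟩
    refine archData_mem_ajTypesOf.2 ⟨⟨⟨pq.1, by omega⟩, ?_, ?_⟩, hdeg⟩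
    · refine Finset.mem_filter.2 ⟨Finset.mem_univ _, z (w pq), LinearMap.mem_range_self z (w pq), h0, ?_⟩
      have hq : 2 * (m + 1) - pq.1 = pq.2 := by omega
      simpa [hq] using htype
    · rw [archData_mem_ajTypes_one_iff]
      ext
      · rfl
      · simp only; omega
  · -- clause (4): each listed type occurs, by the definition of `S`
    intro pq hpq
    obtain ⟨⟨i, hiS, hi⟩, -⟩ := archData_mem_ajTypesOf.1 hpq
    rw [archData_mem_ajTypes_one_iff] at hi
    subst hi
    obtain ⟨-, c, hc, hc0, hct⟩ := Finset.mem_filter.1 hiS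
    exact ⟨c, hc, hc0, by simpa using hct⟩

end Summit.HodgeConjecture.HodgeConjecture.Cruxes.OrthogonalEnveloped.MiddleInvolutionPurity

end
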